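import Mathlib.RingTheory.Localization.AtPrime.Basic
import Mathlib.Algebra.MvPolynomial.CommRing
import HarnessLib

/-!
# Steer / LEMMA I″ kernel (K-I2), FILE D: **contraction of powers of `𝔫` from the hat modulo the exceptional parameter**

OURS (campaign res-hironaka, rung L ★L-G4, slot W4.1, crux `Steer` stmt-ResolutionOfSingularities-16345; res-L0-w41-plan-1
RULING 274 (a) «I″ KERNEL = K-I2 BLUEPRINT … FILE D Contraction», custody res-plan-2 RECORD 19:43:38Z; res-L0-w41-idea-3 g12
blueprint `K-I2-BLUEPRINT.md` 96e1811371a42926 / ae0581fa150ab9c1 §2 D and signature file `K-I2_signatures.lean` 6760785230e5555e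
§FileD (unchanged in v2 e62c805738af0a97) — the statement below is that signature VERBATIM, so that FILE H (`…NonRationalStepNotIsolated`) consumes it by name; replaces the role
of no printed item; NOT a statement of the manuscript under review [claim: Hironaka2017, status: under-review]; AI review is weaker
than expert review). Theses-free, definition-free.

SETTING (abstract chart of a quadratic transform, K-H R3a conventions). `B` is the affine blow-up chart, `𝔮 ⊂ B` a prime with
`S = B_𝔮` local (`IsLocalization.AtPrime S 𝔮`), `Θ : B ↠ K[T, U]` the reduction modulo the exceptional parameter `X_b`
(`ker Θ = (X_b)`) with `Θ⁻¹(𝔫) = 𝔮` for a maximal ideal `𝔫`, and `ι : S → T` a map into a local ring `T` (the hat `Ŝ`) which is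
DENSE (`∀ n t, ∃ a, t − ι a ∈ 𝔪_Tⁿ`) and CONTRACTS powers of the maximal ideal (`ι a ∈ 𝔪_Tⁿ ⇒ a ∈ 𝔪_Sⁿ`).

THEOREM (`apply_mem_pow_of_hat`). If `ι(b) − ι(X_b)·t ∈ 𝔪_Tⁿ` for some `t ∈ T`, then `Θ b ∈ 𝔫ⁿ`.

PROOF. By density pick `a ∈ S` with `t − ι a ∈ 𝔪_Tⁿ`; then `ι(b − X_b a) ∈ 𝔪_Tⁿ`, so `b − X_b a ∈ 𝔪_Sⁿ = 𝔮ⁿS` by the contraction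
clause and `𝔪_S = 𝔮S`. Write `a = a'/s` with `s ∉ 𝔮`; then `(s b − X_b a')/1 ∈ 𝔮ⁿS`, hence `m (s b − X_b a') ∈ 𝔮ⁿ` for some `m ∉ 𝔮`.
Apply `Θ`: `Θ(X_b) = 0` and `Θ(𝔮) ⊆ 𝔫` give `Θ(m)·Θ(s)·Θ(b) ∈ 𝔫ⁿ` with `Θ(m), Θ(s) ∉ 𝔫`; since `𝔫ⁿ` is `𝔫`-primary
(`Ideal.IsMaximal.mul_mem_pow`), `Θ b ∈ 𝔫ⁿ`. (The surjectivity of `Θ` and the inclusion `ker Θ ⊇ (X_b)` are part of the registered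
interface but are not needed for this direction.) [cite: Matsumura1987, Thm. 8.11] [folklore]
-/

noncomputable section

set_option linter.dupNamespace false

open IsLocalRing Module MvPolynomial

namespace Summit.ResolutionOfSingularities.ResolutionOfSingularities.Theorems.SwitchingDichotomy.LemmaI2

variable {K : Type} [Field K]

/-- (D) **CONTRACTION**: if `ι(b) ∈ 𝔪_T^n + ι(X_b)·T` then `Θ b ∈ 𝔫^n`. (Density: `t ≡ ι a (mod 𝔪_T^n)`, so `ι(b − X_b a) ∈ 𝔪_T^n`,
contraction clause ⇒ `b − X_b a ∈ 𝔪_S^n = 𝔮^n S`; clear the denominator `s ∉ 𝔮` and apply `Θ`: `Θ(s)·Θ(b) ∈ 𝔫^n` with `Θ s ∉ 𝔫`, and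
`𝔫^n` is `𝔫`-primary.) OURS, K-I2 FILE D (signature verbatim). [cite: Matsumura1987, Thm. 8.11] [folklore] -/
theorem apply_mem_pow_of_hat {B S T : Type} [CommRing B] [CommRing S] [CommRing T] [Algebra B S] [IsLocalRing S] [IsLocalRing T]
    (𝔮 : Ideal B) [𝔮.IsPrime] [IsLocalization.AtPrime S 𝔮]
    (Θ : B →+* MvPolynomial (Fin 2) K) (hΘ : Function.Surjective Θ) {𝔫 : Ideal (MvPolynomial (Fin 2) K)} [𝔫.IsMaximal]
    (h𝔫 : 𝔫.comap Θ = 𝔮) {Xb : B} (hker : RingHom.ker Θ = Ideal.span {Xb})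
    (ι : S →+* T) (hdense : ∀ (n : ℕ) (t : T), ∃ a : S, t - ι a ∈ maximalIdeal T ^ n)
    (hcontr : ∀ (n : ℕ) (a : S), ι a ∈ maximalIdeal T ^ n → a ∈ maximalIdeal S ^ n)
    (n : ℕ) (b : B) (t : T) (hb : ι (algebraMap B S b) - ι (algebraMap B S Xb) * t ∈ maximalIdeal T ^ n) :
    Θ b ∈ 𝔫 ^ n := by
  classical
  -- the surjectivity of `Θ` is part of the registered interface; it is not needed below
  have _hΘ := hΘ
  -- (1) density: approximate `t` by an element of `S`
  obtain ⟨a, ha⟩ := hdense n t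
  set c : S := algebraMap B S b - algebraMap B S Xb * a with hc_def
  have hιc : ι c ∈ maximalIdeal T ^ n := by
    have hsplit : ι c = (ι (algebraMap B S b) - ι (algebraMap B S Xb) * t) +
        ι (algebraMap B S Xb) * (t - ι a) := by
      simp only [hc_def, map_sub, map_mul]
      ring
    rw [hsplit]
    exact add_mem hb (Ideal.mul_mem_left _ _ ha)
  -- (2) contraction clause and `𝔪_S ^ n = 𝔮 ^ n · S`
  have hc : c ∈ (𝔮 ^ n).map (algebraMap B S) := by
    rw [Ideal.map_pow, IsLocalization.AtPrime.map_eq_maximalIdeal 𝔮 S]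
    exact hcontr n c hιc
  -- (3) clear denominators: `a = a' / s` with `s ∉ 𝔮`
  obtain ⟨⟨a', s⟩, has⟩ := IsLocalization.surj 𝔮.primeCompl a
  have hcs : algebraMap B S ((s : B) * b - Xb * a') ∈ (𝔮 ^ n).map (algebraMap B S) := by
    have hcalc : algebraMap B S ((s : B) * b - Xb * a') = c * algebraMap B S (s : B) := by
      simp only [hc_def, map_sub, map_mul, ← has]
      ring
    rw [hcalc]
    exact Ideal.mul_mem_right _ _ hc
  obtain ⟨m, hm, hmem⟩ :=
    (IsLocalization.algebraMap_mem_map_algebraMap_iff 𝔮.primeCompl S _ _).mp hcs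
  -- (4) apply `Θ`: `Θ X_b = 0`, `Θ (𝔮 ^ n) ⊆ 𝔫 ^ n`
  have hΘXb : Θ Xb = 0 := by
    have hXb : Xb ∈ RingHom.ker Θ := hker ▸ Ideal.mem_span_singleton_self Xb
    exact (RingHom.mem_ker).mp hXb
  have hΘpow : ∀ x ∈ 𝔮 ^ n, Θ x ∈ 𝔫 ^ n := by
    intro x hx
    have hle : Ideal.map Θ (𝔮 ^ n) ≤ 𝔫 ^ n := by
      rw [Ideal.map_pow]
      exact Ideal.pow_right_mono (Ideal.map_le_iff_le_comap.mpr h𝔫.ge) n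
    exact hle (Ideal.mem_map_of_mem Θ hx)
  have hkey : Θ m * (Θ (s : B) * Θ b) ∈ 𝔫 ^ n := by
    have h := hΘpow _ hmem
    simpa only [map_mul, map_sub, hΘXb, zero_mul, sub_zero, mul_assoc] using h
  -- (5) `𝔫 ^ n` is `𝔫`-primary: peel off the two factors outside `𝔫`
  have hnot : ∀ x : B, x ∈ 𝔮.primeCompl → Θ x ∉ 𝔫 := by
    intro x hx hΘx
    apply hx
    rw [← h𝔫]
    exact (Ideal.mem_comap).mpr hΘx
  rcases Ideal.IsMaximal.mul_mem_pow 𝔫 hkey with h | h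
  · exact absurd h (hnot m hm)
  rcases Ideal.IsMaximal.mul_mem_pow 𝔫 h with h' | h'
  · exact absurd h' (hnot (s : B) s.2)
  · exact h'

end Summit.ResolutionOfSingularities.ResolutionOfSingularities.Theorems.SwitchingDichotomy.LemmaI2

end
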